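import Mathlib
import Literature.Barriers.ValiantsHypothesis.AlgebraicNaturalProofs
import Summits.ValiantsHypothesis.ValiantsHypothesis.Theorems.BarrierLeverSuccinctHittingSetsForVPLevelOne
import Summits.ValiantsHypothesis.ValiantsHypothesis.Theorems.BarrierLeverSuccinctHittingSetsForVPShiftedSupport
import Summits.ValiantsHypothesis.ValiantsHypothesis.Theorems.BarrierLeverSuccinctHittingSetsForVPStubProdSparsity
import Summits.ValiantsHypothesis.ValiantsHypothesis.Theorems.BarrierLeverSuccinctHittingSetsForVPStubShiftSmallSupport
import Summits.ValiantsHypothesis.ValiantsHypothesis.Theorems.BarrierLeverSuccinctHittingSetsForVPStubFullSupport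
import Summits.ValiantsHypothesis.ValiantsHypothesis.Theorems.BarrierLeverSuccinctHittingSetsForVPStubSparseGlue
import HarnessLib

/-!
# Crux `BarrierLever.SuccinctHittingSetsForVP` (stmt-ValiantsHypothesis-14610), line `registered` —
SPARSE DISTINGUISHERS ARE HIT (Forbes–Shpilka–Volk 2018 Thm. 9 / Cor. 34 in the tree's regime
`d = n`), and THE CRUX IS EQUIVALENT TO ITS DENSE LEVEL-ONE CASE

**What is proved (unconditional; it settles the SPARSE HALF of the open stub `stub_levelOne` and
reduces the crux to the dense half `stub_dense`; it does NOT close the item).** In FSV's framework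
over `ℂ` (coefficient variables indexed by `degLEMonomials n`, `N = C(2n,n)` of them; simple class
`SmallCircuits ℂ n b = {f : deg f ≤ n, L(f) ≤ n^b}`):

* `Sparse.isSuccinctHittingSet_card_support_lt` (master form): if `f₀ ∈ SmallCircuits ℂ n b'` has
  ALL its `N` coefficients nonzero and `n^b' + t(2n+2) + 1 ≤ n^b`, then the coefficient vectors of
  `SmallCircuits ℂ n b` hit every nonzero polynomial `D` in the coefficient variables with fewer
  than `2^(t+1)` monomials — whatever its degree and circuit size. Dually
  (`Sparse.two_pow_le_card_support_of_vanishes`): an EQUATION of `SmallCircuits ℂ n b` has at least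
  `2^(t+1)` monomials; in polynomial form (`two_pow_le_card_support_of_isNaturalProof`), for
  `n, b ≥ 4` every algebraically natural proof against size `n^b` (FSV Def. 1, any distinguisher
  class) has MORE THAN `2^(n^(b-3))` monomials.
* `isSuccinctHittingSet_sparse` (= registered stub `stub_sparse`): for every sparsity exponent `a`,
  for all `n ≥ 8a + 2`, `SmallCircuits ℂ n 4` is a succinct hitting set for ALL nonzero polynomials
  with at most `N^a` monomials ("`poly(N)`-sparse polynomials = `ΣΠ` circuits of polynomial size are
  hit by coefficient vectors of `polylog(N)`-size degree-`≤ n` circuits": FSV Thm. 9 / Cor. 34, there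
  in the multilinear regime `N = 2^n` via the succinct Shpilka–Volkovich generator, here in the
  regime `d = n`).
* `levelOne_sparse`: in particular FSV Question 6 at level one HOLDS for the level-one
  distinguishers with at most `N` monomials (as many monomials as the level allows gates).
* `levelOne_iff_dense`, `succinctHittingSetsForVP_iff_dense`: hence level one — and by the landed
  level collapse (`succinctHittingSetsForVP_iff_levelOne`, p144631) THE CRUX ITSELF — is EQUIVALENT
  to its DENSE case `stub_dense`: "for some `b`, eventually in `n`, `SmallCircuits ℂ n b` hits every
  nonzero `D` with `L(D) ≤ N`, `deg D ≤ N` and MORE than `N` monomials". What remains open of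
  Question 6 in this regime is exactly the distinguishers with more monomials than gates.

**Proof** (FSV §5–5.1 made succinct in regime `d = n`). If a sparse `D` vanished on
`SmallCircuits ℂ n b`, its Taylor shift to `coeff f₀` would have only monomials with `> t`
variables (landed `card_support_gt_of_shift`, p147641: `f₀ +` a `t`-sparse correction is still a
small circuit). But by FSV Lemma 32 [Forbes 2015; Gurjar–Korwar–Saxena–Thierauf 2016] (landed
`ShiftSmallSupport.exists_narrow_monomial`, p152031, fed by Oliveira's product-sparsity lemma
`stub_prodSparsity`, p152268 = FSV Lemma 33 / FSTW16 Prop. 6.14) the shift of `D` by the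
FULL-SUPPORT vector `coeff f₀` has a monomial `m` with `2^|supp m| ≤ |supp D| < 2^(t+1)`, i.e.
`|supp m| ≤ t` — contradiction. The full-support circuit is `f₀ = (1 + Σ x_i)^n ∈ SmallCircuits ℂ n 3`
(`stub_fullSupport`, p151912), and `N^a ≤ 4^(an) = 2^(2an)`, `n³ + 2an(2n+2) + 1 ≤ n⁴` for
`n ≥ 8a + 2` (`stub_sparseGlue`, p151756). Axioms: `propext`, `Classical.choice`, `Quot.sound`.

References: [ForbesShpilkaVolk2018] Def. 1, Def. 3, Question 6, Thm. 9, Construction 29,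
Lemma 31–33, Cor. 34; Forbes 2015 (PhD thesis) and Gurjar–Korwar–Saxena–Thierauf 2016 for Lemma 32;
Forbes–Saptharishi–Tse–Wigderson 2016 Prop. 6.14 for Lemma 33.
-/

-- layout Summits/ValiantsHypothesis/ValiantsHypothesis forces the duplicated namespace component
set_option linter.dupNamespace false

namespace Summit.ValiantsHypothesis.ValiantsHypothesis.Theorems.BarrierLever.SuccinctHittingSetsForVP

open Literature.Barriers.ValiantsHypothesis Literature.Computability.AlgebraicComplexity MvPolynomial

namespace Sparse

variable {n : ℕ}

/-- **FSV Lemma 32 at the coefficient vector of a full-support polynomial** (unconditional form of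
the landed `ShiftSmallSupport.exists_narrow_monomial`, its product-sparsity hypothesis discharged by
the landed `stub_prodSparsity`): if every coefficient of `f₀` on `degLEMonomials n` is nonzero and
`D ≠ 0`, the Taylor shift of `D` to `coeff f₀` has a monomial `m` with `2^|supp m| ≤ |supp D|`.
[cite: ForbesShpilkaVolk2018, Lemma 32] -/
theorem exists_narrow_monomial_shift {f₀ : MvPolynomial (Fin n) ℂ}
    (hfull : ∀ m : degLEMonomials n, coeff (m : Fin n →₀ ℕ) f₀ ≠ 0)
    {D : MvPolynomial (degLEMonomials n) ℂ} (hD0 : D ≠ 0) :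
    ∃ m ∈ (aeval (fun μ : degLEMonomials n => C (coeff (μ : Fin n →₀ ℕ) f₀) + X μ) D).support,
      2 ^ m.support.card ≤ D.support.card := by
  classical
  exact ShiftSmallSupport.exists_narrow_monomial (fun μ : degLEMonomials n => coeff (μ : Fin n →₀ ℕ) f₀)
    (fun S H hH => stub_prodSparsity _ S _ (fun i _ => hfull i) H hH) hD0

/-- **Master form: polynomials with few monomials are hit.** If `f₀ ∈ SmallCircuits ℂ n b'` has all
its coefficients on `degLEMonomials n` nonzero and `n^b' + t(2n+2) + 1 ≤ n^b`, then the coefficient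
vectors of `SmallCircuits ℂ n b` hit every nonzero polynomial in the coefficient variables with fewer
than `2^(t+1)` monomials (any degree, any size). [cite: ForbesShpilkaVolk2018, Lemma 31 and Cor. 34] -/
theorem isSuccinctHittingSet_card_support_lt {b b' t : ℕ} (h : n ^ b' + t * (2 * n + 2) + 1 ≤ n ^ b)
    {f₀ : MvPolynomial (Fin n) ℂ} (hf₀ : f₀ ∈ SmallCircuits ℂ n b')
    (hfull : ∀ m : degLEMonomials n, coeff (m : Fin n →₀ ℕ) f₀ ≠ 0) :
    IsSuccinctHittingSet (degLEMonomials n) (SmallCircuits ℂ n b)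
      {D : MvPolynomial (degLEMonomials n) ℂ | D.support.card < 2 ^ (t + 1)} := by
  intro D hD hD0
  by_contra hcon
  push Not at hcon
  obtain ⟨m, hm, hmcard⟩ := exists_narrow_monomial_shift hfull hD0
  have hlt : t < m.support.card := card_support_gt_of_shift h hcon hf₀ hm
  have hlt' : 2 ^ m.support.card < 2 ^ (t + 1) := lt_of_le_of_lt hmcard hD
  have := (Nat.pow_lt_pow_iff_right (by norm_num)).mp hlt'
  omega

/-- **Dually: equations of small circuits have exponentially many monomials.** Under the same
hypotheses, a nonzero `D` vanishing at `coeff f` for every `f ∈ SmallCircuits ℂ n b` has at least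
`2^(t+1)` monomials. [cite: ForbesShpilkaVolk2018, Lemma 32 and Def. 1] -/
theorem two_pow_le_card_support_of_vanishes {b b' t : ℕ} (h : n ^ b' + t * (2 * n + 2) + 1 ≤ n ^ b)
    {f₀ : MvPolynomial (Fin n) ℂ} (hf₀ : f₀ ∈ SmallCircuits ℂ n b')
    (hfull : ∀ m : degLEMonomials n, coeff (m : Fin n →₀ ℕ) f₀ ≠ 0)
    {D : MvPolynomial (degLEMonomials n) ℂ} (hD0 : D ≠ 0)
    (hvan : ∀ f ∈ SmallCircuits ℂ n b, eval (coeffVector (degLEMonomials n) f) D = 0) :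
    2 ^ (t + 1) ≤ D.support.card := by
  by_contra hlt
  push Not at hlt
  obtain ⟨f, hf, hne⟩ := isSuccinctHittingSet_card_support_lt h hf₀ hfull D hlt hD0
  exact hne (hvan f hf)

/-- **With the full-support circuit `(1 + Σ x_i)^n ∈ SmallCircuits ℂ n 3`** (landed
`stub_fullSupport`): for `n ≥ 2` and `n³ + t(2n+2) + 1 ≤ n^b`, `SmallCircuits ℂ n b` hits every
nonzero polynomial with fewer than `2^(t+1)` monomials. [cite: ForbesShpilkaVolk2018, Cor. 34] -/
theorem isSuccinctHittingSet_card_support_lt_of_le {b t : ℕ} (hn : 2 ≤ n)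
    (h : n ^ 3 + t * (2 * n + 2) + 1 ≤ n ^ b) :
    IsSuccinctHittingSet (degLEMonomials n) (SmallCircuits ℂ n b)
      {D : MvPolynomial (degLEMonomials n) ℂ | D.support.card < 2 ^ (t + 1)} := by
  obtain ⟨f₀, hf₀, hfull⟩ := stub_fullSupport n hn
  exact isSuccinctHittingSet_card_support_lt h hf₀ hfull

/-- The budget in polynomial form: for `n ≥ 4` and `b ≥ 4`, `n³ + n^(b-3)·(2n+2) + 1 ≤ n^b`.
[folklore] -/
theorem budget_pow {b : ℕ} (hn : 4 ≤ n) (hb : 4 ≤ b) :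
    n ^ 3 + n ^ (b - 3) * (2 * n + 2) + 1 ≤ n ^ b := by
  obtain ⟨c, rfl⟩ : ∃ c, b = c + 4 := ⟨b - 4, by omega⟩
  have hc3 : c + 4 - 3 = c + 1 := by omega
  rw [hc3]
  have h1 : 1 ≤ n ^ c := Nat.one_le_pow _ _ (by omega)
  have hn3 : n ^ 3 ≤ n ^ c * n ^ 3 := Nat.le_mul_of_pos_left _ h1
  have hlin : n ^ (c + 1) * (2 * n + 2) ≤ n ^ c * (3 * n ^ 2) := by
    rw [pow_succ, mul_assoc]
    exact Nat.mul_le_mul_left _ (by nlinarith)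
  have hone : 1 ≤ n ^ c * n ^ 2 := Nat.one_le_iff_ne_zero.mpr (by positivity)
  calc n ^ 3 + n ^ (c + 1) * (2 * n + 2) + 1
      ≤ n ^ c * n ^ 3 + n ^ c * (3 * n ^ 2) + n ^ c * n ^ 2 := by gcongr
    _ = n ^ c * (n ^ 3 + 4 * n ^ 2) := by ring
    _ ≤ n ^ c * (n ^ 3 + n * n ^ 2) := by gcongr
    _ ≤ n ^ c * n ^ 4 := by
        refine Nat.mul_le_mul_left _ ?_
        have h2 : n ^ 3 + n * n ^ 2 = 2 * n ^ 3 := by ring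
        rw [h2]
        calc 2 * n ^ 3 ≤ n * n ^ 3 := Nat.mul_le_mul_right _ (by omega)
          _ = n ^ 4 := by ring
    _ = n ^ (c + 4) := by ring

/-- **Polynomial form of the sparsity lower bound**: for `n ≥ 4`, `b ≥ 4`, every equation of
`SmallCircuits ℂ n b` — a nonzero polynomial in the `C(2n,n)` coefficient variables vanishing at the
coefficient vector of every degree-`≤ n` polynomial of size `≤ n^b` — has more than `2^(n^(b-3))`
monomials. [cite: ForbesShpilkaVolk2018, Lemma 32 and Def. 1] -/
theorem two_pow_pow_lt_card_support_of_vanishes {b : ℕ} (hn : 4 ≤ n) (hb : 4 ≤ b)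
    {D : MvPolynomial (degLEMonomials n) ℂ} (hD0 : D ≠ 0)
    (hvan : ∀ f ∈ SmallCircuits ℂ n b, eval (coeffVector (degLEMonomials n) f) D = 0) :
    2 ^ (n ^ (b - 3)) < D.support.card := by
  obtain ⟨f₀, hf₀, hfull⟩ := stub_fullSupport n (by omega)
  have := two_pow_le_card_support_of_vanishes (budget_pow hn hb) hf₀ hfull hD0 hvan
  calc 2 ^ (n ^ (b - 3)) < 2 ^ (n ^ (b - 3) + 1) := Nat.pow_lt_pow_right (by norm_num) (by omega)
    _ ≤ D.support.card := this

end Sparse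

open Sparse

/-- **Natural proofs against `VP` are exponentially dense.** For `n ≥ 4`, `b ≥ 4`: an algebraically
natural proof `D` against `SmallCircuits ℂ n b` in the sense of FSV Def. 1 (for ANY distinguisher
class `𝒟`, of any constructivity) has more than `2^(n^(b-3))` monomials — no `ΣΠ` circuit
(sparse polynomial) of size `2^(n^(b-3))`, in particular none of size `poly(N)`, `N = C(2n,n) < 4^n`,
once `b ≥ 5`, is a natural proof against size-`n^b` circuits. [cite: ForbesShpilkaVolk2018, Thm. 9 and Def. 1] -/
theorem two_pow_lt_card_support_of_isNaturalProof {n b : ℕ} (hn : 4 ≤ n) (hb : 4 ≤ b)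
    {𝒟 : Set (MvPolynomial (degLEMonomials n) ℂ)} {D : MvPolynomial (degLEMonomials n) ℂ}
    (hD : IsNaturalProof (degLEMonomials n) (SmallCircuits ℂ n b) 𝒟 D) :
    2 ^ (n ^ (b - 3)) < D.support.card :=
  two_pow_pow_lt_card_support_of_vanishes hn hb hD.2.1 hD.2.2

/-- **Sparse distinguishers are hit — FSV Thm. 9 / Cor. 34 in regime `d = n`** (unconditional
assembly of the four landed stubs `stub_prodSparsity`, `stub_shiftSmallSupport`, `stub_fullSupport`,
`stub_sparseGlue`): for every sparsity exponent `a` there is `n₀` (`= 8a + 2`) such that for all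
`n ≥ n₀` the coefficient vectors of `SmallCircuits ℂ n 4` (degree `≤ n`, size `≤ n⁴`) hit EVERY
nonzero polynomial in the `N = C(2n,n)` coefficient variables with at most `N^a` monomials, of any
degree and any circuit size. [cite: ForbesShpilkaVolk2018, Thm. 9 and Cor. 34] -/
theorem isSuccinctHittingSet_sparse :
    ∀ a : ℕ, ∃ n₀ : ℕ, ∀ n : ℕ, n₀ ≤ n →
      IsSuccinctHittingSet (degLEMonomials n) (SmallCircuits ℂ n 4)
        {D : MvPolynomial (degLEMonomials n) ℂ | D.support.card ≤ Nat.choose (2 * n) n ^ a} :=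
  stub_sparseGlue stub_prodSparsity stub_shiftSmallSupport stub_fullSupport

/-- **Registered stub `stub_sparse`** (crux stmt-ValiantsHypothesis-14610, line `registered`; the
SPARSE HALF of level one, settled): verbatim `isSuccinctHittingSet_sparse`.
[cite: ForbesShpilkaVolk2018, Thm. 9 and Cor. 34] -/
theorem stub_sparse :
    ∀ a : ℕ, ∃ n₀ : ℕ, ∀ n : ℕ, n₀ ≤ n →
      IsSuccinctHittingSet (degLEMonomials n) (SmallCircuits ℂ n 4)
        {D | D.support.card ≤ Nat.choose (2 * n) n ^ a} :=
  isSuccinctHittingSet_sparse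

/-- **Level one of FSV Question 6 holds for sparse level-one distinguishers**: for `n ≥ 10`,
`SmallCircuits ℂ n 4` hits every nonzero `D ∈ Distinguishers ℂ n 1` (`L(D) ≤ N`, `deg D ≤ N`) with
at most `N = C(2n,n)` monomials. [cite: ForbesShpilkaVolk2018, Question 6 and Thm. 9] -/
theorem levelOne_sparse :
    ∃ n₀ : ℕ, ∀ n : ℕ, n₀ ≤ n →
      IsSuccinctHittingSet (degLEMonomials n) (SmallCircuits ℂ n 4)
        (Distinguishers ℂ n 1 ∩ {D | D.support.card ≤ Nat.choose (2 * n) n}) := by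
  obtain ⟨n₀, h⟩ := isSuccinctHittingSet_sparse 1
  refine ⟨n₀, fun n hn => (h n hn).mono le_rfl ?_⟩
  rintro D ⟨-, hD⟩
  simpa only [Set.mem_setOf_eq, pow_one] using hD

/-- **Level one from its dense case.** If for some `b`, eventually in `n`, `SmallCircuits ℂ n b`
hits the level-one distinguishers with MORE than `N` monomials, then level one of Question 6 holds
(at size exponent `max 4 b`): the sparse ones are hit by `levelOne_sparse`.
[cite: ForbesShpilkaVolk2018, Question 6] -/
theorem levelOne_of_dense
    (hd : ∃ b n₀ : ℕ, ∀ n : ℕ, n₀ ≤ n →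
      IsSuccinctHittingSet (degLEMonomials n) (SmallCircuits ℂ n b)
        (Distinguishers ℂ n 1 ∩ {D | Nat.choose (2 * n) n < D.support.card})) :
    ∃ b n₀ : ℕ, ∀ n : ℕ, n₀ ≤ n →
      IsSuccinctHittingSet (degLEMonomials n) (SmallCircuits ℂ n b) (Distinguishers ℂ n 1) := by
  obtain ⟨n₁, hs⟩ := levelOne_sparse
  obtain ⟨b, n₂, hd⟩ := hd
  refine ⟨max 4 b, max (max n₁ n₂) 1, fun n hn => ?_⟩
  have hn₁ : n₁ ≤ n := le_trans (le_max_left _ _) (le_trans (le_max_left _ _) hn)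
  have hn₂ : n₂ ≤ n := le_trans (le_max_right _ _) (le_trans (le_max_left _ _) hn)
  have hn1 : 1 ≤ n := le_trans (le_max_right _ _) hn
  intro D hD hD0
  by_cases hcard : D.support.card ≤ Nat.choose (2 * n) n
  · obtain ⟨f, hf, hne⟩ := hs n hn₁ D ⟨hD, hcard⟩ hD0
    exact ⟨f, smallCircuits_mono ℂ (le_max_left 4 b) hn1 hf, hne⟩
  · obtain ⟨f, hf, hne⟩ := hd n hn₂ D ⟨hD, not_le.mp hcard⟩ hD0
    exact ⟨f, smallCircuits_mono ℂ (le_max_right 4 b) hn1 hf, hne⟩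

/-- Conversely level one trivially gives its dense case. [folklore] -/
theorem dense_of_levelOne
    (h : ∃ b n₀ : ℕ, ∀ n : ℕ, n₀ ≤ n →
      IsSuccinctHittingSet (degLEMonomials n) (SmallCircuits ℂ n b) (Distinguishers ℂ n 1)) :
    ∃ b n₀ : ℕ, ∀ n : ℕ, n₀ ≤ n →
      IsSuccinctHittingSet (degLEMonomials n) (SmallCircuits ℂ n b)
        (Distinguishers ℂ n 1 ∩ {D | Nat.choose (2 * n) n < D.support.card}) := by
  obtain ⟨b, n₀, h⟩ := h
  exact ⟨b, n₀, fun n hn => (h n hn).mono le_rfl Set.inter_subset_left⟩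

/-- **Level one ⟺ its dense case.** [cite: ForbesShpilkaVolk2018, Question 6 and Thm. 9] -/
theorem levelOne_iff_dense :
    (∃ b n₀ : ℕ, ∀ n : ℕ, n₀ ≤ n →
      IsSuccinctHittingSet (degLEMonomials n) (SmallCircuits ℂ n b) (Distinguishers ℂ n 1)) ↔
    ∃ b n₀ : ℕ, ∀ n : ℕ, n₀ ≤ n →
      IsSuccinctHittingSet (degLEMonomials n) (SmallCircuits ℂ n b)
        (Distinguishers ℂ n 1 ∩ {D | Nat.choose (2 * n) n < D.support.card}) :=
  ⟨dense_of_levelOne, levelOne_of_dense⟩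

/-- **THE CRUX IS EQUIVALENT TO ITS DENSE LEVEL-ONE CASE.** FSV Question 6 over `ℂ` in the tree's
regime (the route's crux `BarrierLever.SuccinctHittingSetsForVP`, every level `a`) holds iff for
some `b`, eventually in `n`, the coefficient vectors of `SmallCircuits ℂ n b` hit every nonzero `D`
in the `N = C(2n,n)` coefficient variables with `L(D) ≤ N`, `deg D ≤ N` and MORE THAN `N` monomials
(the registered open stub `stub_dense`). [cite: ForbesShpilkaVolk2018, Question 6 and Thm. 9] -/
theorem succinctHittingSetsForVP_iff_dense :
    Summit.ValiantsHypothesis.ValiantsHypothesis.Theses.BarrierLever.SuccinctHittingSetsForVP ↔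
      ∃ b n₀ : ℕ, ∀ n : ℕ, n₀ ≤ n →
        IsSuccinctHittingSet (degLEMonomials n) (SmallCircuits ℂ n b)
          (Distinguishers ℂ n 1 ∩ {D | Nat.choose (2 * n) n < D.support.card}) :=
  succinctHittingSetsForVP_iff_levelOne.trans levelOne_iff_dense

end Summit.ValiantsHypothesis.ValiantsHypothesis.Theorems.BarrierLever.SuccinctHittingSetsForVP
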